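import Summits.Ventures.HodgeRepro2.T5SU11JacobiDuplication
import Summits.Ventures.HodgeRepro2.T5SU11JacobiThreeFour
import Summits.Ventures.HodgeRepro2.T5SU11JacobiWeightTwo
import Summits.Ventures.HodgeRepro2.T5BergmanCoefficientLpNorm

/-!
# The spherical transform of the lowest-`K`-type coefficient modulus `|⟨π_k(g) 1, 1⟩_k|` in closed form

The lowest-weight matrix coefficient of the weight-`k` Bergman model satisfies
`|⟨π_k(g) 1, 1⟩_k| = (π/(k−1)) |a(g)|^{-k}` (`T5BergmanIntegrableSharp.norm_matrixCoeff_lowest_lowest`),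
and `|a(g)|^{-k} = (1 − |g·0|²)^{k/2} = m_k(g)` (`T5SU11JacobiThreshold.orbit_rpow_eq_norm_mat_inv_rpow`);
so the coefficient modulus IS `⟨1,1⟩_k · m_k` (`norm_matrixCoeff_lowest_lowest_eq_orbit_rpow`; the same
from the `K`-type closed form of `T5BergmanKTypeMatrix` at `m = n = 0`, `kCoeff k g 0 0 = 1` and
`⟨1,1⟩_k = π/(k−1)`: `norm_matrixCoeff_monomial_zero_zero`). Its spherical transform is therefore the
Jacobi transform of `T5SU11JacobiDuplication` times `π/(k−1)`:

  **`∫_G |⟨π_k(g) 1, 1⟩_k| φ_λ(g) dν = (π/(k−1)) · π Γ((k−λ)/2) Γ((k+λ)/2 − 1)/Γ(k/2)²`**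

for `k ≥ 2`, `λ < k`, `k + λ > 2` (`integral_norm_matrixCoeff_lowest_lowest_mul_sph`), and for the
`p`-th power `(π/(k−1))^p · m̂_{kp}(λ)` (`integral_norm_matrixCoeff_lowest_lowest_rpow_mul_sph`). In
elementary form: **weight `3`** (the model `π₃⁺` of the owner's datum)
`∫_G |⟨π_3(g) 1, 1⟩_3| φ_λ dν = π²(1 − λ)/cos(πλ/2)` on `−1 < λ < 3`, `λ ≠ 1`, with the critical value
`2π` at `λ = 1` (`integral_norm_matrixCoeff_three_mul_sph`, `…_one`); **weight `2`**
`π³/sin(πλ/2)` on `0 < λ < 2` (`integral_norm_matrixCoeff_two_mul_sph`). At `λ = 0` the transform is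
the `L¹` norm `2π²/((k−1)(k−2))` (`k ≥ 3`), re-derived both from the closed form and from the
`L^p`-norm formula of `T5BergmanCoefficientLpNorm` (`integral_norm_matrixCoeff_lowest_lowest_mul_sph_zero`,
`…_zero'`); the square modulus at `λ = 0` is the Schur relation `(π/(k−1))² · π/(k−1)`
(`integral_norm_matrixCoeff_lowest_lowest_sq_mul_sph_zero`). Nothing is claimed about (N).

Blind lane: Mathlib + the HodgeRepro2 prefix only; no sorry; axioms ⊆ {propext, Classical.choice,
Quot.sound}.
-/

namespace Summit.Ventures.HodgeRepro2.T5SU11CoeffSphericalTransform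

open MeasureTheory MeasureTheory.Measure Metric Set Filter Topology Finset
open T5SU11Unimodular T5SU11Fibration T5SU11Cartan T5HaarCircle T5BergmanCoefficient
  T5SU11FibrationHaar T5SU11SphericalFunction T5SU11SphericalSymmetry T5SU11JacobiIwasawa
  T5SU11JacobiTransform T5SU11XiTransform T5SU11JacobiThreshold T5SU11JacobiThreeFour
  T5SU11JacobiWeightTwo T5SU11JacobiDuplication
  T5BergmanPairing T5BergmanParseval T5BergmanMatrixCoeff T5BergmanKernel T5BergmanKTypeMatrix
  T5BergmanIntegrableSharp T5BergmanCoefficientLpNorm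
open scoped Real

/-! ### Pointwise: the lowest-weight coefficient modulus is `⟨1,1⟩_k · m_k` -/

/-- **`|⟨π_k(g) 1, 1⟩_k| = (π/(k−1)) · (1 − |g·0|²)^{k/2}`** for `k ≥ 2`. -/
theorem norm_matrixCoeff_lowest_lowest_eq_orbit_rpow (k : ℕ) (hk : 2 ≤ k) (g : SU11) :
    ‖matrixCoeff k lowest lowest g‖
      = π / ((k : ℝ) - 1) * (1 - ‖orbit g‖ ^ 2) ^ ((k : ℝ) / 2) := by
  rw [norm_matrixCoeff_lowest_lowest k hk g, orbit_rpow_eq_norm_mat_inv_rpow, Real.rpow_natCast]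

/-- `|⟨π_k(g) 1, 1⟩_k|^p = (π/(k−1))^p · (1 − |g·0|²)^{kp/2}` for `k ≥ 2` and every real `p`. -/
theorem norm_matrixCoeff_lowest_lowest_rpow_eq_orbit_rpow (k : ℕ) (hk : 2 ≤ k) (p : ℝ) (g : SU11) :
    ‖matrixCoeff k lowest lowest g‖ ^ p
      = (π / ((k : ℝ) - 1)) ^ p * (1 - ‖orbit g‖ ^ 2) ^ ((k : ℝ) * p / 2) := by
  rw [norm_matrixCoeff_lowest_lowest_rpow k hk p g, orbit_rpow_eq_norm_mat_inv_rpow]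

/-- `kCoeff k g 0 0 = 1`: the `K`-type expansion of `π_k(g) 1` starts with the constant term `1`. -/
theorem kCoeff_zero_zero (k : ℕ) (g : SU11) : kCoeff k g 0 0 = 1 := by
  simp [kCoeff, polyCoeff, kernelCoeff]

/-- `⟨1, 1⟩_k = π/(k − 1)` for `k ≥ 2` (`monomialNormSq k 0`). -/
theorem monomialNormSq_zero (k : ℕ) (hk : 2 ≤ k) : monomialNormSq k 0 = π / ((k : ℝ) - 1) := by
  obtain ⟨m, rfl⟩ : ∃ m, k = m + 2 := ⟨k - 2, by omega⟩
  have e1 : m + 2 - 2 = m := by omega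
  have e2 : 0 + (m + 2) - 1 = m + 1 := by omega
  simp only [monomialNormSq, Nat.factorial_zero, Nat.cast_one, one_mul, e1, e2, Nat.factorial_succ,
    Nat.cast_mul, Nat.cast_add, Nat.cast_ofNat]
  have hm : (0 : ℝ) < (m : ℝ) + 1 := by positivity
  have hf : (0 : ℝ) < (Nat.factorial m : ℝ) := by positivity
  rw [show (m : ℝ) + 2 - 1 = (m : ℝ) + 1 by ring, div_eq_div_iff (by positivity) hm.ne']
  ring

/-- **Cross-check through the `K`-type closed form** (`T5BergmanKTypeMatrix.matrixCoeff_monomial_monomial`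
at `m = n = 0`): `⟨π_k(g) z⁰, z⁰⟩_k = a(g)^{-k} · π/(k − 1)`. -/
theorem matrixCoeff_monomial_zero_zero (k : ℕ) (hk : 2 ≤ k) (g : SU11) :
    matrixCoeff k (fun z => z ^ 0) (fun z => z ^ 0) g
      = (mat g 0 0)⁻¹ ^ k * ((π / ((k : ℝ) - 1) : ℝ) : ℂ) := by
  rw [matrixCoeff_monomial_monomial k hk g 0 0, kCoeff_zero_zero, mul_one, add_zero,
    monomialNormSq_zero k hk]

/-- The modulus of the `K`-type closed form at `m = n = 0` is `(π/(k−1)) m_k(g)` — the same function as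
`norm_matrixCoeff_lowest_lowest_eq_orbit_rpow` (`z⁰ = 1` on the disc). -/
theorem norm_matrixCoeff_monomial_zero_zero (k : ℕ) (hk : 2 ≤ k) (g : SU11) :
    ‖matrixCoeff k (fun z => z ^ 0) (fun z => z ^ 0) g‖
      = π / ((k : ℝ) - 1) * (1 - ‖orbit g‖ ^ 2) ^ ((k : ℝ) / 2) := by
  have hk1 : (1 : ℝ) < k := by exact_mod_cast (by omega : 1 < k)
  have hc : (0 : ℝ) < π / ((k : ℝ) - 1) := div_pos Real.pi_pos (by linarith)
  rw [matrixCoeff_monomial_zero_zero k hk g, norm_mul, norm_pow, norm_inv, Complex.norm_real,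
    Real.norm_eq_abs, abs_of_pos hc, orbit_rpow_eq_norm_mat_inv_rpow, Real.rpow_natCast, mul_comm]

/-- The two closed forms agree: `⟨π_k(g) z⁰, z⁰⟩_k = ⟨π_k(g) 1, 1⟩_k`. -/
theorem matrixCoeff_monomial_zero_zero_eq_lowest (k : ℕ) (g : SU11) :
    matrixCoeff k (fun z => z ^ 0) (fun z => z ^ 0) g = matrixCoeff k lowest lowest g := by
  have e : (fun z : ℂ => z ^ 0) = lowest := by
    funext z
    simp [lowest]
  rw [e]

/-! ### The spherical transform -/

section measure

variable [MeasurableSpace Circle] [BorelSpace Circle]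

/-- **THE SPHERICAL TRANSFORM OF THE LOWEST-WEIGHT COEFFICIENT MODULUS IN CLOSED FORM**: for `k ≥ 2`,
`λ < k`, `k + λ > 2`,
`∫_G |⟨π_k(g) 1, 1⟩_k| φ_λ(g) dν = (π/(k−1)) · π Γ((k−λ)/2) Γ((k+λ)/2 − 1)/Γ(k/2)²`. -/
theorem integral_norm_matrixCoeff_lowest_lowest_mul_sph (k : ℕ) (hk : 2 ≤ k) {lam : ℝ}
    (h1 : lam < k) (h2 : 2 < k + lam) :
    ∫ g, ‖matrixCoeff k lowest lowest g‖ * sph lam g ∂(nu haarCircle)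
      = π / ((k : ℝ) - 1) * (π * Real.Gamma (((k : ℝ) - lam) / 2) * Real.Gamma (((k : ℝ) + lam) / 2 - 1)
          / Real.Gamma ((k : ℝ) / 2) ^ 2) := by
  have hk1 : (1 : ℝ) < k := by exact_mod_cast (by omega : 1 < k)
  simp_rw [norm_matrixCoeff_lowest_lowest_eq_orbit_rpow k hk, mul_assoc]
  rw [integral_const_mul, integral_orbit_rpow_mul_sph_dup hk1 h1 h2]
  ring

/-- `|⟨π_k(g) 1, 1⟩_k| φ_λ` is `ν`-integrable for `k ≥ 2`, `λ < k`, `k + λ > 2`. -/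
theorem integrable_norm_matrixCoeff_lowest_lowest_mul_sph (k : ℕ) (hk : 2 ≤ k) {lam : ℝ}
    (h1 : lam < k) (h2 : 2 < k + lam) :
    Integrable (fun g => ‖matrixCoeff k lowest lowest g‖ * sph lam g) (nu haarCircle) := by
  have hk1 : (1 : ℝ) < k := by exact_mod_cast (by omega : 1 < k)
  simp_rw [norm_matrixCoeff_lowest_lowest_eq_orbit_rpow k hk, mul_assoc]
  exact (integrable_orbit_rpow_mul_sph hk1 h1 h2).const_mul _

/-- **The `p`-th power**: for `k ≥ 2`, `kp > 1`, `λ < kp`, `kp + λ > 2`,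
`∫_G |⟨π_k(g) 1, 1⟩_k|^p φ_λ(g) dν = (π/(k−1))^p · π Γ((kp−λ)/2) Γ((kp+λ)/2 − 1)/Γ(kp/2)²`. -/
theorem integral_norm_matrixCoeff_lowest_lowest_rpow_mul_sph (k : ℕ) (hk : 2 ≤ k) {p lam : ℝ}
    (hp : 1 < (k : ℝ) * p) (h1 : lam < (k : ℝ) * p) (h2 : 2 < (k : ℝ) * p + lam) :
    ∫ g, ‖matrixCoeff k lowest lowest g‖ ^ p * sph lam g ∂(nu haarCircle)
      = (π / ((k : ℝ) - 1)) ^ p * (π * Real.Gamma (((k : ℝ) * p - lam) / 2)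
          * Real.Gamma (((k : ℝ) * p + lam) / 2 - 1) / Real.Gamma ((k : ℝ) * p / 2) ^ 2) := by
  simp_rw [norm_matrixCoeff_lowest_lowest_rpow_eq_orbit_rpow k hk p, mul_assoc]
  rw [integral_const_mul, integral_orbit_rpow_mul_sph_dup hp h1 h2]
  ring

/-- **The square modulus**: for `k ≥ 2`, `λ < 2k`, `2k + λ > 2`,
`∫_G |⟨π_k(g) 1, 1⟩_k|² φ_λ(g) dν = (π/(k−1))² · π Γ(k − λ/2) Γ(k + λ/2 − 1)/Γ(k)²`. -/
theorem integral_norm_matrixCoeff_lowest_lowest_sq_mul_sph (k : ℕ) (hk : 2 ≤ k) {lam : ℝ}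
    (h1 : lam < 2 * k) (h2 : 2 < 2 * k + lam) :
    ∫ g, ‖matrixCoeff k lowest lowest g‖ ^ 2 * sph lam g ∂(nu haarCircle)
      = (π / ((k : ℝ) - 1)) ^ 2 * (π * Real.Gamma ((k : ℝ) - lam / 2)
          * Real.Gamma ((k : ℝ) + lam / 2 - 1) / Real.Gamma (k : ℝ) ^ 2) := by
  have hk1 : (1 : ℝ) < k := by exact_mod_cast (by omega : 1 < k)
  have h := integral_norm_matrixCoeff_lowest_lowest_rpow_mul_sph k hk (p := 2) (lam := lam)
    (by linarith) (by linarith) (by linarith)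
  simp_rw [Real.rpow_two] at h
  rw [h, show ((k : ℝ) * 2 - lam) / 2 = (k : ℝ) - lam / 2 by ring,
    show ((k : ℝ) * 2 + lam) / 2 - 1 = (k : ℝ) + lam / 2 - 1 by ring,
    show (k : ℝ) * 2 / 2 = (k : ℝ) by ring]

/-! ### Elementary forms: the weights `3` and `2` -/

/-- **Weight `3`** (the model `π₃⁺`): for `−1 < λ < 3`, `λ ≠ 1`,
`∫_G |⟨π_3(g) 1, 1⟩_3| φ_λ(g) dν = π²(1 − λ)/cos(πλ/2)`. -/
theorem integral_norm_matrixCoeff_three_mul_sph {lam : ℝ} (h1 : -1 < lam) (h2 : lam < 3)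
    (h3 : lam ≠ 1) :
    ∫ g, ‖matrixCoeff 3 lowest lowest g‖ * sph lam g ∂(nu haarCircle)
      = π ^ 2 * (1 - lam) / Real.cos (π * lam / 2) := by
  simp_rw [norm_matrixCoeff_lowest_lowest_eq_orbit_rpow 3 (by norm_num), mul_assoc]
  rw [integral_const_mul, Nat.cast_ofNat, integral_orbit_rpow_three_mul_sph h1 h2 h3]
  ring

/-- **Weight `3`, the critical value**: `∫_G |⟨π_3(g) 1, 1⟩_3| Ξ(g) dν = 2π`. -/
theorem integral_norm_matrixCoeff_three_mul_sph_one :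
    ∫ g, ‖matrixCoeff 3 lowest lowest g‖ * sph 1 g ∂(nu haarCircle) = 2 * π := by
  simp_rw [norm_matrixCoeff_lowest_lowest_eq_orbit_rpow 3 (by norm_num), mul_assoc]
  rw [integral_const_mul, Nat.cast_ofNat, integral_orbit_rpow_three_mul_sph_one]
  ring

/-- **Weight `3`, `λ = 0`**: the `L¹` norm `∫_G |⟨π_3(g) 1, 1⟩_3| dν = π²`. -/
theorem integral_norm_matrixCoeff_three :
    ∫ g, ‖matrixCoeff 3 lowest lowest g‖ ∂(nu haarCircle) = π ^ 2 := by
  simp_rw [norm_matrixCoeff_lowest_lowest_eq_orbit_rpow 3 (by norm_num)]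
  rw [integral_const_mul, Nat.cast_ofNat, integral_orbit_rpow_three]
  ring

/-- **Weight `2`** (the border case): for `0 < λ < 2`,
`∫_G |⟨π_2(g) 1, 1⟩_2| φ_λ(g) dν = π³/sin(πλ/2)`. -/
theorem integral_norm_matrixCoeff_two_mul_sph {lam : ℝ} (h1 : 0 < lam) (h2 : lam < 2) :
    ∫ g, ‖matrixCoeff 2 lowest lowest g‖ * sph lam g ∂(nu haarCircle)
      = π ^ 3 / Real.sin (π * lam / 2) := by
  simp_rw [norm_matrixCoeff_lowest_lowest_eq_orbit_rpow 2 le_rfl, mul_assoc]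
  rw [integral_const_mul, Nat.cast_ofNat, integral_orbit_rpow_two_mul_sph h1 h2]
  ring

/-- **Weight `2`, the critical value**: `∫_G |⟨π_2(g) 1, 1⟩_2| Ξ(g) dν = π³`. -/
theorem integral_norm_matrixCoeff_two_mul_sph_one :
    ∫ g, ‖matrixCoeff 2 lowest lowest g‖ * sph 1 g ∂(nu haarCircle) = π ^ 3 := by
  rw [integral_norm_matrixCoeff_two_mul_sph (by norm_num) (by norm_num), mul_one,
    Real.sin_pi_div_two, div_one]

/-! ### `λ = 0`: the `L¹` norm, two ways; `λ = 0` for the square: the Schur relation -/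

/-- **`λ = 0`** from the closed form: `∫_G |⟨π_k(g) 1, 1⟩_k| dν = 2π²/((k−1)(k−2))` for `k ≥ 3`. -/
theorem integral_norm_matrixCoeff_lowest_lowest_mul_sph_zero (k : ℕ) (hk : 3 ≤ k) :
    ∫ g, ‖matrixCoeff k lowest lowest g‖ * sph 0 g ∂(nu haarCircle)
      = 2 * π ^ 2 / (((k : ℝ) - 1) * ((k : ℝ) - 2)) := by
  have hk2 : (2 : ℝ) < k := by exact_mod_cast (by omega : 2 < k)
  simp_rw [norm_matrixCoeff_lowest_lowest_eq_orbit_rpow k (by omega), mul_assoc]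
  rw [integral_const_mul, integral_orbit_rpow_mul_sph_dup_zero hk2]
  have h1 : (k : ℝ) - 1 ≠ 0 := by
    intro h
    linarith
  have h2 : (k : ℝ) - 2 ≠ 0 := by
    intro h
    linarith
  field_simp

/-- The same value from the `L^p`-norm formula of `T5BergmanCoefficientLpNorm` at `p = 1`
(`integral_norm_matrixCoeff_lowest_lowest_rpow` against `ν` itself, `haarScalarFactor ν ν = 1`). -/
theorem integral_norm_matrixCoeff_lowest_lowest_mul_sph_zero' (k : ℕ) (hk : 3 ≤ k) :
    ∫ g, ‖matrixCoeff k lowest lowest g‖ * sph 0 g ∂(nu haarCircle)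
      = 2 * π ^ 2 / (((k : ℝ) - 1) * ((k : ℝ) - 2)) := by
  have hk2 : (2 : ℝ) < k := by exact_mod_cast (by omega : 2 < k)
  have h := integral_norm_matrixCoeff_lowest_lowest_rpow (nu haarCircle) k (by omega) (p := 1)
    (by linarith)
  rw [haarScalarFactor_self, NNReal.coe_one, one_smul] at h
  simp only [Real.rpow_one, mul_one] at h
  simp_rw [sph_zero, mul_one]
  rw [h]
  have h1 : (k : ℝ) - 1 ≠ 0 := by
    intro h
    linarith
  have h2 : (k : ℝ) - 2 ≠ 0 := by
    intro h
    linarith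
  field_simp

/-- **The Schur relation as the value at `λ = 0` of the transform of the square modulus**:
`∫_G |⟨π_k(g) 1, 1⟩_k|² dν = (π/(k−1))² · π/(k−1)` for `k ≥ 2` (the formal degree `k − 1` against
`μ_R = π⁻¹ ν`). -/
theorem integral_norm_matrixCoeff_lowest_lowest_sq_mul_sph_zero (k : ℕ) (hk : 2 ≤ k) :
    ∫ g, ‖matrixCoeff k lowest lowest g‖ ^ 2 * sph 0 g ∂(nu haarCircle)
      = (π / ((k : ℝ) - 1)) ^ 2 * (π / ((k : ℝ) - 1)) := by
  have hk1 : (1 : ℝ) < k := by exact_mod_cast (by omega : 1 < k)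
  rw [integral_norm_matrixCoeff_lowest_lowest_sq_mul_sph k hk (by linarith) (by linarith)]
  have hne : (k : ℝ) - 1 ≠ 0 := by
    intro h
    linarith
  have hG : Real.Gamma (k : ℝ) = ((k : ℝ) - 1) * Real.Gamma ((k : ℝ) - 1) := by
    rw [← Real.Gamma_add_one hne, sub_add_cancel]
  have g1 : 0 < Real.Gamma ((k : ℝ) - 1) := Real.Gamma_pos_of_pos (by linarith)
  rw [zero_div, sub_zero, add_zero, hG]
  set G := Real.Gamma ((k : ℝ) - 1) with hGdef
  clear_value G
  have g1' : G ≠ 0 := g1.ne'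
  field_simp

end measure

end Summit.Ventures.HodgeRepro2.T5SU11CoeffSphericalTransform
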